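import Summits.BirchSwinnertonDyer.BirchSwinnertonDyer.Theorems.PrintCFramBottomClassIndexLawFiveLeBorelDescentClaimA
import HarnessLib

/-!
# Route `PrintCFram`, crux C2 `BottomClassIndexLawFiveLe` (stmt-BirchSwinnertonDyer-20372), line
# `eisenstein-resource-bdp-line`, stub `stub_kolyvaginUpper_borelCM_pairSum_offKrizLi`:
# **KOLYVAGIN'S DESCENT UNDER THE BOREL ČEBOTAREV AXIOM, II — CLAIM B WITHOUT CLAIM A**
# (cell `bsd-print-cfram`, seat `bsd-line-cfram-p1-w2` g7; helper `--supports` 20372; 0 defs, 0 facts, 0 sorry)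

HONEST FRAMING. Nothing about BSD is proved here and nothing of the stub itself; pure algebra, sequel of
`…BorelDescentClaimA` (data (B1)–(B4) and the dictionary `p^a v = 0 ↔ dp v ≤ 2a` explained there).

* `claimB_core` — **one Kolyvagin step WITHOUT Claim A**: for `s ∈ Sel^{ε}` top-independent of `x`, ANY
  Kolyvagin prime `ℓ` and `t ≥ 1` with `ord d(ℓ)_λ ≥ p^t` (`p^{t−1}c(ℓ) ∉ Loc λ`):
  `⌈dp s/2⌉ + ⌊dp c(ℓ)/2⌋ + t ≤ 2M`. The tree's `HypothesesM.claimB_indep` calls Prop. 10.2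
  (`p^{M₀}c(ℓ′) = 0`, i.e. Claim A for `c(ℓ′)`); here that call is replaced by local duality of the Selmer
  class `c(ℓ′)` against `d(ℓ)` AT `λ`, which gives `p^{M−t}c(ℓ′)_λ = 0` — all that is needed to make
  `p^{M−t}c(ℓℓ′)` Selmer off `λ′`. So the `(−ε)`-side losses of Claim A never enter Claim B.
* `exists_stepA_prime` — shape (B1) on `y`: a Kolyvagin prime with `ord d(ℓ)_λ = p^{M−M₀}`.
* `claimB_indep_borel` **`p^{2M₀+1} s = 0`** (`t = M − M₀`; the one lost step is the prescribed order of the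
  `(−ε)`-class `c(ℓ)` when its depth is odd) and `claimB_indep_borel_of_even` **`p^{2M₀} s = 0`** — the
  VERBATIM bound — as soon as ONE step-A prime carries a class `c(ℓ)` of EVEN depth;
  `claimB_borel`, `claimB_borel_of_even` (split off `x` by (B4)).

READING. The ENTIRE residual of sharpness in Claim B at the Borel prime is one parity: the `𝓞`-depth of
the step-A class `c(ℓ)`, i.e. the `𝔭`-adic divisibility of the derived Heegner point `D_ℓ y_ℓ`
(`Lines/eisenstein-resource-bdp-line-w2g7-notes.md` §3). THEOREMS ONLY; no definition, no named fact, no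
`sorry`. BSD is not proved by any of this; no summit statement is proved by this seat.
References: [McCallumLMS1991] §§4–5 (Lemma 4.3, Prop. 4.4, Lemma 5.3, Thm. 5.4); [GrossLMS1991] §10.
-/

set_option autoImplicit false
-- `…BirchSwinnertonDyer.BirchSwinnertonDyer.Theorems…` is the problem's mandated namespace (D-0017).
set_option linter.dupNamespace false

noncomputable section

open scoped Classical

universe u

namespace Summit.BirchSwinnertonDyer.BirchSwinnertonDyer.Theorems.PrintCFram.BorelDescent

open WeierstrassCurve Literature.NumberTheory.EllipticCurves
  Literature.NumberTheory.EllipticCurves.KolyvaginDescent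
  Summit.BirchSwinnertonDyer.BirchSwinnertonDyer.Theorems.SylvesterTwoUpper.DescentDefect

/-! ## §3 Claim B at the Borel prime, WITHOUT Claim A -/

section ClaimB

variable {V : Type*} [AddCommGroup V] {Pl : Type*}
variable {p M M₀ : ℕ} {ε : ℤ} {τ : V →+ V} {Sel : AddSubgroup V} {Loc : Pl → AddSubgroup V}
  {Kol : ℕ → Prop} {pl : ℕ → Pl} {Dv : Pl → ℕ → Prop} {A : ℕ → AddSubgroup V} {x : V} {c : ℕ → V}
  {dp : V → ℕ} {TopIndep : V → V → Prop}

/-- **One Kolyvagin step at the Borel prime, without Claim A (core of Claim B).** For `s ∈ Sel^{ε}`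
top-independent of `x`, a Kolyvagin prime `ℓ` and `1 ≤ t ≤ M` with `ord d(ℓ)_λ ≥ p^t`
(`p^{t−1} c(ℓ) ∉ Loc λ`): **`⌈dp s/2⌉ + ⌊dp c(ℓ)/2⌋ + t ≤ 2M`**, i.e.
`ord s · (best local order of c(ℓ)) · ord d(ℓ)_λ ≤ p^{2M}`. PROOF (McCallum §5 with one change): the
triple shape (B3) gives `ℓ′ > ℓ` with `x_{λ′} = 0`, `ord s_{λ′} = ord s`, `ord c(ℓ)_{λ′} = p^{⌊dp c(ℓ)/2⌋}`.
Then `c(ℓ′)` is Selmer (Prop. 4.4 at `λ′`, Lemma 4.3), of sign `−ε`, and — THIS replaces the tree's call of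
Prop. 10.2 / Claim A — duality of `c(ℓ′)` against `d(ℓ)` at `λ` gives `p^{M−t} c(ℓ′)_λ = 0`; so
`d′ = p^{M−t} c(ℓℓ′)` (sign `ε`) is Selmer off `λ′` (Prop. 4.4 at `λ`), has
`ord d′_{λ′} = p^{⌊dp c(ℓ)/2⌋ − (M − t)}` (Prop. 4.4 at `λ′`), and duality with `s` at `λ′` gives the bound.
[cite: GrossLMS1991, §10 Claim 10.3] [cite: McCallumLMS1991, §5 (proof of Thm. 5.4)] -/
theorem claimB_core (hε : ε = 1 ∨ ε = -1)
    (htor : ∀ v : V, ((p : ℤ) ^ M) • v = 0)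
    (hSel : ∀ s, s ∈ Sel ↔ ∀ v, s ∈ Loc v)
    (hKol : ∀ ℓ, Kol ℓ → ℓ.Prime) (hdv : ∀ ℓ, Kol ℓ → ∀ v, Dv v ℓ ↔ v = pl ℓ)
    (hdvm : ∀ ℓ ℓ', Kol ℓ → Kol ℓ' → ∀ v, Dv v (ℓ * ℓ') → Dv v ℓ ∨ Dv v ℓ')
    (hc1 : c 1 = ((p : ℤ) ^ M₀) • x)
    (hτc : ∀ n, KolSupp Kol n → τ (c n) = (ε * (-1) ^ n.primeFactors.card) • c n)
    (hcloc : ∀ n, KolSupp Kol n → ∀ v, ¬ Dv v n → c n ∈ Loc v)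
    (hc44 : ∀ ℓ m, Kol ℓ → KolSupp Kol (ℓ * m) → ∀ a : ℕ,
      (((p : ℤ) ^ a) • c (ℓ * m) ∈ Loc (pl ℓ)) ↔ ((p : ℤ) ^ a) • c m ∈ A ℓ)
    (hdual : ∀ ℓ, Kol ℓ → ∀ ν : ℤ, (ν = 1 ∨ ν = -1) → ∀ d, τ d = ν • d →
      (∀ v, v ≠ pl ℓ → d ∈ Loc v) → ∀ s ∈ Sel, τ s = ν • s →
      ∀ a, a < M → ((p : ℤ) ^ a) • d ∉ Loc (pl ℓ) → ((p : ℤ) ^ (M - 1 - a)) • s ∈ A ℓ)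
    (hdp : ∀ (v : V) (a : ℕ), ((p : ℤ) ^ a) • v = 0 ↔ dp v ≤ 2 * a)
    (hceb3 : ∀ (s w : V) (Ns Nw : ℕ), s ≠ 0 → w ≠ 0 → τ s = ε • s → τ w = (-ε) • w →
      TopIndep x s → 2 * Ns ≤ dp s + 1 → 2 * Nw ≤ dp w → ∀ b : ℕ, ∃ ℓ, b < ℓ ∧ Kol ℓ ∧ x ∈ A ℓ ∧
        (((p : ℤ) ^ Ns) • s ∈ A ℓ ∧ (Ns ≠ 0 → ((p : ℤ) ^ (Ns - 1)) • s ∉ A ℓ)) ∧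
        (((p : ℤ) ^ Nw) • w ∈ A ℓ ∧ (Nw ≠ 0 → ((p : ℤ) ^ (Nw - 1)) • w ∉ A ℓ)))
    {s : V} (hs : s ∈ Sel) (hτs : τ s = ε • s) (hind : TopIndep x s)
    {ℓ : ℕ} (hℓ : Kol ℓ) {t : ℕ} (ht1 : 1 ≤ t) (htM : t ≤ M)
    (hd : ((p : ℤ) ^ (t - 1)) • c ℓ ∉ Loc (pl ℓ)) :
    (dp s + 1) / 2 + dp (c ℓ) / 2 + t ≤ 2 * M := by
  have hsM : dp s ≤ 2 * M := dp_le_two_mul hdp htor s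
  have hcM : dp (c ℓ) ≤ 2 * M := dp_le_two_mul hdp htor (c ℓ)
  -- trivial ranges
  by_cases hk : dp (c ℓ) / 2 + t ≤ M
  · omega
  by_cases hs0 : s = 0
  · have : dp s = 0 := (eq_zero_iff_dp_eq_zero hdp s).1 hs0
    omega
  have hNs : (dp s + 1) / 2 ≠ 0 := by
    have := (eq_zero_iff_dp_eq_zero hdp s).not.1 hs0
    omega
  have hc0 : c ℓ ≠ 0 := by
    rintro h
    exact hd (by rw [h, smul_zero]; exact zero_mem _)
  have hτcℓ : τ (c ℓ) = (-ε) • c ℓ := τ_c_prime hKol hτc hℓ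
  -- Čebotarev, triple shape: `x_{λ′} = 0`, `ord s_{λ′} = ord s`, `ord c(ℓ)_{λ′} = p^{⌊dp c(ℓ)/2⌋}`
  obtain ⟨ℓ', hlt, hℓ', hxA, ⟨-, hsA⟩, ⟨-, hcA⟩⟩ := hceb3 s (c ℓ) ((dp s + 1) / 2) (dp (c ℓ) / 2)
    hs0 hc0 hτs hτcℓ hind (by omega) (Nat.mul_div_le (dp (c ℓ)) 2) ℓ
  have hsA' := hsA hNs
  have hcA' := hcA (by omega)
  have hne : ℓ ≠ ℓ' := hlt.ne
  -- `c(ℓ′) ∈ Sel^{−ε}`; duality against `d(ℓ)` at `λ`: `p^{M−t} c(ℓ′)_λ = 0`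
  have hcSel : c ℓ' ∈ Sel := c_mem_sel_of_x_mem hKol hSel hdv hc1 hcloc hc44 hℓ' hxA
  have hdu1 := hdual ℓ hℓ (-ε) (neg_sign hε) (c ℓ) hτcℓ
    (fun v hv ↦ c_mem_loc_of_ne hKol hdv hcloc hℓ hv) (c ℓ') hcSel (τ_c_prime hKol hτc hℓ')
    (t - 1) (by omega) hd
  rw [show M - 1 - (t - 1) = M - t by omega] at hdu1
  -- `d′ = p^{M−t} c(ℓℓ′)` is Selmer off `λ′`
  have hsupp : KolSupp Kol (ℓ * ℓ') := kolSupp_mul (hKol ℓ hℓ) (hKol ℓ' hℓ') hne hℓ hℓ'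
  have hsupp' : KolSupp Kol (ℓ' * ℓ) := by rwa [mul_comm] at hsupp
  set d' := ((p : ℤ) ^ (M - t)) • c (ℓ * ℓ') with hd'
  have hτd' : τ d' = ε • d' := by
    simp only [hd', map_zsmul, τ_c_mul hKol hτc hℓ hℓ' hne, smul_comm _ ε]
  have hatℓ : d' ∈ Loc (pl ℓ) := (hc44 ℓ ℓ' hℓ hsupp (M - t)).2 hdu1
  have hoff : ∀ v, v ≠ pl ℓ' → d' ∈ Loc v := by
    intro v hv
    by_cases hvℓ : v = pl ℓ
    · rw [hvℓ]
      exact hatℓ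
    by_cases hdvv : Dv v (ℓ * ℓ')
    · rcases hdvm ℓ ℓ' hℓ hℓ' v hdvv with h | h
      · exact absurd ((hdv ℓ hℓ v).mp h) hvℓ
      · exact absurd ((hdv ℓ' hℓ' v).mp h) hv
    · exact (Loc v).zsmul_mem (hcloc _ hsupp v hdvv) _
  -- at `λ′`: `ord d′_{λ′} = p^{⌊dp c(ℓ)/2⌋ − (M − t)}`
  have hat : ((p : ℤ) ^ (dp (c ℓ) / 2 - 1 - (M - t))) • d' ∉ Loc (pl ℓ') := by
    intro h
    rw [hd', smul_smul, ← pow_add,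
      show dp (c ℓ) / 2 - 1 - (M - t) + (M - t) = dp (c ℓ) / 2 - 1 by omega, mul_comm ℓ ℓ'] at h
    exact hcA' ((hc44 ℓ' ℓ hℓ' hsupp' (dp (c ℓ) / 2 - 1)).1 h)
  have hdu2 := hdual ℓ' hℓ' ε hε d' hτd' hoff s hs hτs (dp (c ℓ) / 2 - 1 - (M - t)) (by omega) hat
  -- duality at `λ′`: `ord s_{λ′} ≤ p^{2M − ⌊dp c(ℓ)/2⌋ − t}`
  by_contra hlt
  exact hsA' (pow_zsmul_mem_of_le
    (show M - 1 - (dp (c ℓ) / 2 - 1 - (M - t)) ≤ (dp s + 1) / 2 - 1 by omega) hdu2)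

/-- A step-A prime: for `M₀ < M`, shape (B1) applied to `y` gives a Kolyvagin prime `ℓ` with
`ord d(ℓ)_λ = p^{M−M₀}` (`p^{M−M₀−1} c(ℓ) ∉ Loc λ`), hence `2(M − M₀) ≤ dp c(ℓ) + 1`.
[cite: McCallumLMS1991, §5 (proof of Thm. 5.4)] -/
theorem exists_stepA_prime (hKol : ∀ ℓ, Kol ℓ → ℓ.Prime)
    (hxord : ((p : ℤ) ^ (M - 1)) • x ≠ 0) (hτx : τ x = ε • x)
    (hc1 : c 1 = ((p : ℤ) ^ M₀) • x)
    (hc44 : ∀ ℓ m, Kol ℓ → KolSupp Kol (ℓ * m) → ∀ a : ℕ,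
      (((p : ℤ) ^ a) • c (ℓ * m) ∈ Loc (pl ℓ)) ↔ ((p : ℤ) ^ a) • c m ∈ A ℓ)
    (hdp : ∀ (v : V) (a : ℕ), ((p : ℤ) ^ a) • v = 0 ↔ dp v ≤ 2 * a)
    (hceb1 : ∀ (u : V) (Nu : ℕ), u ≠ 0 → τ u = ε • u → 2 * Nu ≤ dp u + 1 →
      ∀ b : ℕ, ∃ ℓ, b < ℓ ∧ Kol ℓ ∧ ((p : ℤ) ^ Nu) • u ∈ A ℓ ∧
        (Nu ≠ 0 → ((p : ℤ) ^ (Nu - 1)) • u ∉ A ℓ))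
    (hM₀ : M₀ < M) (b : ℕ) :
    ∃ ℓ, b < ℓ ∧ Kol ℓ ∧ ((p : ℤ) ^ (M - M₀ - 1)) • c ℓ ∉ Loc (pl ℓ) ∧
      2 * (M - M₀) ≤ dp (c ℓ) + 1 := by
  have hydp : 2 * (M - M₀) ≤ dp (((p : ℤ) ^ M₀) • x) + 1 := by
    have := two_mul_succ_le_dp_of_ne_zero hdp (pow_zsmul_y_ne_zero hxord hM₀)
    omega
  obtain ⟨ℓ, hb, hℓ, -, hyA⟩ := hceb1 (((p : ℤ) ^ M₀) • x) (M - M₀) (y_ne_zero hxord hM₀) (τ_y hτx)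
    hydp b
  have hd : ((p : ℤ) ^ (M - M₀ - 1)) • c ℓ ∉ Loc (pl ℓ) := fun h ↦
    hyA (by omega) ((c_mem_loc_iff_one hKol hc1 hc44 hℓ _).1 h)
  refine ⟨ℓ, hb, hℓ, hd, ?_⟩
  have hne : ((p : ℤ) ^ (M - M₀ - 1)) • c ℓ ≠ 0 := fun h ↦ hd (by rw [h]; exact zero_mem _)
  have := two_mul_succ_le_dp_of_ne_zero hdp hne
  omega

/-- **Claim B at the Borel prime for classes top-independent of `x`: `p^{2M₀+1} s = 0`** for
`s ∈ Sel^{ε}` with `TopIndep x s`. From `claimB_core` at a step-A prime (`t = M − M₀`, and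
`⌊dp c(ℓ)/2⌋ ≥ M − M₀ − 1`): `ord s ≤ p^{2M₀+1}`. The verbatim exponent is `2M₀`; the one lost step is the
prescribed local order of the `(−ε)`-class `c(ℓ)` when its depth is odd.
[cite: GrossLMS1991, §10 Claim 10.3] [cite: McCallumLMS1991, §5 (proof of Thm. 5.4)] -/
theorem claimB_indep_borel (hε : ε = 1 ∨ ε = -1)
    (htor : ∀ v : V, ((p : ℤ) ^ M) • v = 0)
    (hSel : ∀ s, s ∈ Sel ↔ ∀ v, s ∈ Loc v)
    (hKol : ∀ ℓ, Kol ℓ → ℓ.Prime) (hdv : ∀ ℓ, Kol ℓ → ∀ v, Dv v ℓ ↔ v = pl ℓ)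
    (hdvm : ∀ ℓ ℓ', Kol ℓ → Kol ℓ' → ∀ v, Dv v (ℓ * ℓ') → Dv v ℓ ∨ Dv v ℓ')
    (hxord : ((p : ℤ) ^ (M - 1)) • x ≠ 0) (hτx : τ x = ε • x)
    (hc1 : c 1 = ((p : ℤ) ^ M₀) • x)
    (hτc : ∀ n, KolSupp Kol n → τ (c n) = (ε * (-1) ^ n.primeFactors.card) • c n)
    (hcloc : ∀ n, KolSupp Kol n → ∀ v, ¬ Dv v n → c n ∈ Loc v)
    (hc44 : ∀ ℓ m, Kol ℓ → KolSupp Kol (ℓ * m) → ∀ a : ℕ,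
      (((p : ℤ) ^ a) • c (ℓ * m) ∈ Loc (pl ℓ)) ↔ ((p : ℤ) ^ a) • c m ∈ A ℓ)
    (hdual : ∀ ℓ, Kol ℓ → ∀ ν : ℤ, (ν = 1 ∨ ν = -1) → ∀ d, τ d = ν • d →
      (∀ v, v ≠ pl ℓ → d ∈ Loc v) → ∀ s ∈ Sel, τ s = ν • s →
      ∀ a, a < M → ((p : ℤ) ^ a) • d ∉ Loc (pl ℓ) → ((p : ℤ) ^ (M - 1 - a)) • s ∈ A ℓ)
    (hdp : ∀ (v : V) (a : ℕ), ((p : ℤ) ^ a) • v = 0 ↔ dp v ≤ 2 * a)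
    (hceb1 : ∀ (u : V) (Nu : ℕ), u ≠ 0 → τ u = ε • u → 2 * Nu ≤ dp u + 1 →
      ∀ b : ℕ, ∃ ℓ, b < ℓ ∧ Kol ℓ ∧ ((p : ℤ) ^ Nu) • u ∈ A ℓ ∧
        (Nu ≠ 0 → ((p : ℤ) ^ (Nu - 1)) • u ∉ A ℓ))
    (hceb3 : ∀ (s w : V) (Ns Nw : ℕ), s ≠ 0 → w ≠ 0 → τ s = ε • s → τ w = (-ε) • w →
      TopIndep x s → 2 * Ns ≤ dp s + 1 → 2 * Nw ≤ dp w → ∀ b : ℕ, ∃ ℓ, b < ℓ ∧ Kol ℓ ∧ x ∈ A ℓ ∧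
        (((p : ℤ) ^ Ns) • s ∈ A ℓ ∧ (Ns ≠ 0 → ((p : ℤ) ^ (Ns - 1)) • s ∉ A ℓ)) ∧
        (((p : ℤ) ^ Nw) • w ∈ A ℓ ∧ (Nw ≠ 0 → ((p : ℤ) ^ (Nw - 1)) • w ∉ A ℓ)))
    {s : V} (hs : s ∈ Sel) (hτs : τ s = ε • s) (hind : TopIndep x s) :
    ((p : ℤ) ^ (2 * M₀ + 1)) • s = 0 := by
  rcases Nat.lt_or_ge M₀ M with hM₀ | hM₀
  swap
  · exact pow_zsmul_eq_zero_of_le (by omega) (htor s)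
  obtain ⟨ℓ, -, hℓ, hd, hk⟩ := exists_stepA_prime hKol hxord hτx hc1 hc44 hdp hceb1 hM₀ 0
  have core := claimB_core hε htor hSel hKol hdv hdvm hc1 hτc hcloc hc44 hdual hdp hceb3 hs hτs hind
    hℓ (t := M - M₀) (by omega) (by omega) hd
  exact (hdp s _).2 (by omega)

/-- **The verbatim Claim B at the Borel prime: `p^{2M₀} s = 0`** for `s ∈ Sel^{ε}` top-independent of
`x`, AS SOON AS one step-A prime `ℓ` (`ord d(ℓ)_λ = p^{M−M₀}`, i.e. `p^{M−M₀−1} c(ℓ) ∉ Loc λ`) carries a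
class `c(ℓ)` of EVEN depth (then `⌊dp c(ℓ)/2⌋ ≥ M − M₀` and `claimB_core` returns McCallum's exponent).
This isolates the whole residual of sharpness in one parity.
[cite: GrossLMS1991, §10 Claim 10.3] [cite: McCallumLMS1991, §5 (proof of Thm. 5.4)] -/
theorem claimB_indep_borel_of_even (hε : ε = 1 ∨ ε = -1)
    (htor : ∀ v : V, ((p : ℤ) ^ M) • v = 0)
    (hSel : ∀ s, s ∈ Sel ↔ ∀ v, s ∈ Loc v)
    (hKol : ∀ ℓ, Kol ℓ → ℓ.Prime) (hdv : ∀ ℓ, Kol ℓ → ∀ v, Dv v ℓ ↔ v = pl ℓ)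
    (hdvm : ∀ ℓ ℓ', Kol ℓ → Kol ℓ' → ∀ v, Dv v (ℓ * ℓ') → Dv v ℓ ∨ Dv v ℓ')
    (hc1 : c 1 = ((p : ℤ) ^ M₀) • x)
    (hτc : ∀ n, KolSupp Kol n → τ (c n) = (ε * (-1) ^ n.primeFactors.card) • c n)
    (hcloc : ∀ n, KolSupp Kol n → ∀ v, ¬ Dv v n → c n ∈ Loc v)
    (hc44 : ∀ ℓ m, Kol ℓ → KolSupp Kol (ℓ * m) → ∀ a : ℕ,
      (((p : ℤ) ^ a) • c (ℓ * m) ∈ Loc (pl ℓ)) ↔ ((p : ℤ) ^ a) • c m ∈ A ℓ)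
    (hdual : ∀ ℓ, Kol ℓ → ∀ ν : ℤ, (ν = 1 ∨ ν = -1) → ∀ d, τ d = ν • d →
      (∀ v, v ≠ pl ℓ → d ∈ Loc v) → ∀ s ∈ Sel, τ s = ν • s →
      ∀ a, a < M → ((p : ℤ) ^ a) • d ∉ Loc (pl ℓ) → ((p : ℤ) ^ (M - 1 - a)) • s ∈ A ℓ)
    (hdp : ∀ (v : V) (a : ℕ), ((p : ℤ) ^ a) • v = 0 ↔ dp v ≤ 2 * a)
    (hceb3 : ∀ (s w : V) (Ns Nw : ℕ), s ≠ 0 → w ≠ 0 → τ s = ε • s → τ w = (-ε) • w →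
      TopIndep x s → 2 * Ns ≤ dp s + 1 → 2 * Nw ≤ dp w → ∀ b : ℕ, ∃ ℓ, b < ℓ ∧ Kol ℓ ∧ x ∈ A ℓ ∧
        (((p : ℤ) ^ Ns) • s ∈ A ℓ ∧ (Ns ≠ 0 → ((p : ℤ) ^ (Ns - 1)) • s ∉ A ℓ)) ∧
        (((p : ℤ) ^ Nw) • w ∈ A ℓ ∧ (Nw ≠ 0 → ((p : ℤ) ^ (Nw - 1)) • w ∉ A ℓ)))
    {s : V} (hs : s ∈ Sel) (hτs : τ s = ε • s) (hind : TopIndep x s)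
    {ℓ : ℕ} (hℓ : Kol ℓ) (hd : ((p : ℤ) ^ (M - M₀ - 1)) • c ℓ ∉ Loc (pl ℓ))
    (heven : Even (dp (c ℓ))) :
    ((p : ℤ) ^ (2 * M₀)) • s = 0 := by
  rcases Nat.lt_or_ge M₀ M with hM₀ | hM₀
  swap
  · exact pow_zsmul_eq_zero_of_le (by omega) (htor s)
  have hne : ((p : ℤ) ^ (M - M₀ - 1)) • c ℓ ≠ 0 := fun h ↦ hd (by rw [h]; exact zero_mem _)
  have hk := two_mul_succ_le_dp_of_ne_zero hdp hne
  obtain ⟨k, hk2⟩ := heven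
  have core := claimB_core hε htor hSel hKol hdv hdvm hc1 hτc hcloc hc44 hdual hdp hceb3 hs hτs hind
    hℓ (t := M - M₀) (by omega) (by omega) hd
  exact (hdp s _).2 (by omega)

/-- **Claim B at the Borel prime: `p^{2M₀+1} s ∈ ℤx` for every `s ∈ Sel^{ε}`** — split `s = k·x + s′`
with `s′` top-independent of `x` (shape (B4); `s′ ∈ Sel^{ε}` as `x ∈ Sel^{ε}`) and apply
`claimB_indep_borel` to `s′`. [cite: GrossLMS1991, §10 Claim 10.3] -/
theorem claimB_borel (hε : ε = 1 ∨ ε = -1)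
    (htor : ∀ v : V, ((p : ℤ) ^ M) • v = 0)
    (hSel : ∀ s, s ∈ Sel ↔ ∀ v, s ∈ Loc v)
    (hKol : ∀ ℓ, Kol ℓ → ℓ.Prime) (hdv : ∀ ℓ, Kol ℓ → ∀ v, Dv v ℓ ↔ v = pl ℓ)
    (hdvm : ∀ ℓ ℓ', Kol ℓ → Kol ℓ' → ∀ v, Dv v (ℓ * ℓ') → Dv v ℓ ∨ Dv v ℓ')
    (hxSel : x ∈ Sel) (hxord : ((p : ℤ) ^ (M - 1)) • x ≠ 0) (hτx : τ x = ε • x)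
    (hc1 : c 1 = ((p : ℤ) ^ M₀) • x)
    (hτc : ∀ n, KolSupp Kol n → τ (c n) = (ε * (-1) ^ n.primeFactors.card) • c n)
    (hcloc : ∀ n, KolSupp Kol n → ∀ v, ¬ Dv v n → c n ∈ Loc v)
    (hc44 : ∀ ℓ m, Kol ℓ → KolSupp Kol (ℓ * m) → ∀ a : ℕ,
      (((p : ℤ) ^ a) • c (ℓ * m) ∈ Loc (pl ℓ)) ↔ ((p : ℤ) ^ a) • c m ∈ A ℓ)
    (hdual : ∀ ℓ, Kol ℓ → ∀ ν : ℤ, (ν = 1 ∨ ν = -1) → ∀ d, τ d = ν • d →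
      (∀ v, v ≠ pl ℓ → d ∈ Loc v) → ∀ s ∈ Sel, τ s = ν • s →
      ∀ a, a < M → ((p : ℤ) ^ a) • d ∉ Loc (pl ℓ) → ((p : ℤ) ^ (M - 1 - a)) • s ∈ A ℓ)
    (hdp : ∀ (v : V) (a : ℕ), ((p : ℤ) ^ a) • v = 0 ↔ dp v ≤ 2 * a)
    (hsplit : ∀ s, τ s = ε • s → ∃ (k : ℤ) (s' : V), s = k • x + s' ∧ TopIndep x s')
    (hceb1 : ∀ (u : V) (Nu : ℕ), u ≠ 0 → τ u = ε • u → 2 * Nu ≤ dp u + 1 →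
      ∀ b : ℕ, ∃ ℓ, b < ℓ ∧ Kol ℓ ∧ ((p : ℤ) ^ Nu) • u ∈ A ℓ ∧
        (Nu ≠ 0 → ((p : ℤ) ^ (Nu - 1)) • u ∉ A ℓ))
    (hceb3 : ∀ (s w : V) (Ns Nw : ℕ), s ≠ 0 → w ≠ 0 → τ s = ε • s → τ w = (-ε) • w →
      TopIndep x s → 2 * Ns ≤ dp s + 1 → 2 * Nw ≤ dp w → ∀ b : ℕ, ∃ ℓ, b < ℓ ∧ Kol ℓ ∧ x ∈ A ℓ ∧
        (((p : ℤ) ^ Ns) • s ∈ A ℓ ∧ (Ns ≠ 0 → ((p : ℤ) ^ (Ns - 1)) • s ∉ A ℓ)) ∧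
        (((p : ℤ) ^ Nw) • w ∈ A ℓ ∧ (Nw ≠ 0 → ((p : ℤ) ^ (Nw - 1)) • w ∉ A ℓ)))
    {s : V} (hs : s ∈ Sel) (hτs : τ s = ε • s) :
    ∃ a : ℤ, ((p : ℤ) ^ (2 * M₀ + 1)) • s = a • x := by
  obtain ⟨k, s', hsplit', hind⟩ := hsplit s hτs
  have hs'eq : s' = s - k • x := by rw [hsplit']; abel
  have hs' : s' ∈ Sel := by
    rw [hs'eq]
    exact Sel.sub_mem hs (Sel.zsmul_mem hxSel _)
  have hτs' : τ s' = ε • s' := by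
    rw [hs'eq, map_sub, map_zsmul, hτs, hτx, zsmul_sub, smul_comm]
  have h0 := claimB_indep_borel hε htor hSel hKol hdv hdvm hxord hτx hc1 hτc hcloc hc44 hdual hdp hceb1
    hceb3 hs' hτs' hind
  refine ⟨(p : ℤ) ^ (2 * M₀ + 1) * k, ?_⟩
  rw [hsplit', zsmul_add, h0, add_zero, smul_smul]

/-- **The verbatim Claim B `p^{2M₀} s ∈ ℤx` on `Sel^{ε}`**, given one step-A prime whose class `c(ℓ)`
has even depth (`claimB_indep_borel_of_even` after the split (B4)). [cite: GrossLMS1991, §10 Claim 10.3] -/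
theorem claimB_borel_of_even (hε : ε = 1 ∨ ε = -1)
    (htor : ∀ v : V, ((p : ℤ) ^ M) • v = 0)
    (hSel : ∀ s, s ∈ Sel ↔ ∀ v, s ∈ Loc v)
    (hKol : ∀ ℓ, Kol ℓ → ℓ.Prime) (hdv : ∀ ℓ, Kol ℓ → ∀ v, Dv v ℓ ↔ v = pl ℓ)
    (hdvm : ∀ ℓ ℓ', Kol ℓ → Kol ℓ' → ∀ v, Dv v (ℓ * ℓ') → Dv v ℓ ∨ Dv v ℓ')
    (hxSel : x ∈ Sel) (hτx : τ x = ε • x)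
    (hc1 : c 1 = ((p : ℤ) ^ M₀) • x)
    (hτc : ∀ n, KolSupp Kol n → τ (c n) = (ε * (-1) ^ n.primeFactors.card) • c n)
    (hcloc : ∀ n, KolSupp Kol n → ∀ v, ¬ Dv v n → c n ∈ Loc v)
    (hc44 : ∀ ℓ m, Kol ℓ → KolSupp Kol (ℓ * m) → ∀ a : ℕ,
      (((p : ℤ) ^ a) • c (ℓ * m) ∈ Loc (pl ℓ)) ↔ ((p : ℤ) ^ a) • c m ∈ A ℓ)
    (hdual : ∀ ℓ, Kol ℓ → ∀ ν : ℤ, (ν = 1 ∨ ν = -1) → ∀ d, τ d = ν • d →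
      (∀ v, v ≠ pl ℓ → d ∈ Loc v) → ∀ s ∈ Sel, τ s = ν • s →
      ∀ a, a < M → ((p : ℤ) ^ a) • d ∉ Loc (pl ℓ) → ((p : ℤ) ^ (M - 1 - a)) • s ∈ A ℓ)
    (hdp : ∀ (v : V) (a : ℕ), ((p : ℤ) ^ a) • v = 0 ↔ dp v ≤ 2 * a)
    (hsplit : ∀ s, τ s = ε • s → ∃ (k : ℤ) (s' : V), s = k • x + s' ∧ TopIndep x s')
    (hceb3 : ∀ (s w : V) (Ns Nw : ℕ), s ≠ 0 → w ≠ 0 → τ s = ε • s → τ w = (-ε) • w →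
      TopIndep x s → 2 * Ns ≤ dp s + 1 → 2 * Nw ≤ dp w → ∀ b : ℕ, ∃ ℓ, b < ℓ ∧ Kol ℓ ∧ x ∈ A ℓ ∧
        (((p : ℤ) ^ Ns) • s ∈ A ℓ ∧ (Ns ≠ 0 → ((p : ℤ) ^ (Ns - 1)) • s ∉ A ℓ)) ∧
        (((p : ℤ) ^ Nw) • w ∈ A ℓ ∧ (Nw ≠ 0 → ((p : ℤ) ^ (Nw - 1)) • w ∉ A ℓ)))
    {ℓ : ℕ} (hℓ : Kol ℓ) (hd : ((p : ℤ) ^ (M - M₀ - 1)) • c ℓ ∉ Loc (pl ℓ))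
    (heven : Even (dp (c ℓ)))
    {s : V} (hs : s ∈ Sel) (hτs : τ s = ε • s) :
    ∃ a : ℤ, ((p : ℤ) ^ (2 * M₀)) • s = a • x := by
  obtain ⟨k, s', hsplit', hind⟩ := hsplit s hτs
  have hs'eq : s' = s - k • x := by rw [hsplit']; abel
  have hs' : s' ∈ Sel := by
    rw [hs'eq]
    exact Sel.sub_mem hs (Sel.zsmul_mem hxSel _)
  have hτs' : τ s' = ε • s' := by
    rw [hs'eq, map_sub, map_zsmul, hτs, hτx, zsmul_sub, smul_comm]
  have h0 := claimB_indep_borel_of_even hε htor hSel hKol hdv hdvm hc1 hτc hcloc hc44 hdual hdp hceb3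
    hs' hτs' hind hℓ hd heven
  refine ⟨(p : ℤ) ^ (2 * M₀) * k, ?_⟩
  rw [hsplit', zsmul_add, h0, add_zero, smul_smul]

end ClaimB

end Summit.BirchSwinnertonDyer.BirchSwinnertonDyer.Theorems.PrintCFram.BorelDescent

end
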